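import Summits.Ventures.PercRepro.RankLevelSetRuleQSumS
import Summits.Ventures.PercRepro.KroneckerPIT

/-!
# PercRepro — THE CHAIN OF THE MASTER SUM AS EXPRESSION TREES (p4, gen 27; C-044; paper proofs/P4-CELL-THREE.md §13.7 (a))

The recurrence `(q+m+1)·S(q,m+1) = 2(m+1)·S(q,m) + q` folds, for every `j`, into
`D_j(q,m)·S(q,m+j) = A_j(q,m)·S(q,m) + B_j(q,m)` with `D_j = Π_{l ≤ j}(q+m+l)`, `A_j = 2^j·(m+1)⋯(m+j)`,
`B_j = 2(m+j)·B_{j−1} + q·D_{j−1}` (`chain_eq`).  Here `D_j`, `A_j`, `B_j` and the partial products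
`DD_{j,c} = Π_{l=j+1}^{j+c}(q+m+l)` (`chainD_add`: `D_{j+c} = DD_{j,c}·D_j`) are defined as `PercRepro.PIT.PExpr`
trees (`Dexpr`, `Aexpr`, `Bexpr`, `DDexpr`) evaluated at `(q, m)`, so that the key identity of every family
`k` (`D_{k−1}·Σ_i (k−1)!·C(n,i)·W_i = pwX·S + pw0`) reduces to two polynomial identities in `(q, m)` checked
by ONE Kronecker evaluation each (`pitE`).  No `sorry`; axioms standard.
-/

namespace PercRepro

open PIT

/-- `D_j = Π_{l=1}^{j}(q+m+l)` as an expression tree. -/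
def Dexpr : ℕ → PExpr
  | 0 => .const 1
  | j + 1 => .mul (Dexpr j) (.add (.add .va .vb) (.const (j + 1)))

/-- `A_j = 2^j·(m+1)⋯(m+j)` as an expression tree. -/
def Aexpr : ℕ → PExpr
  | 0 => .const 1
  | j + 1 => .mul (Aexpr j) (.mul (.const 2) (.add .vb (.const (j + 1))))

/-- `B_j` (`B_0 = 0`, `B_{j+1} = 2(m+j+1)·B_j + q·D_j`) as an expression tree. -/
def Bexpr : ℕ → PExpr
  | 0 => .const 0
  | j + 1 => .add (.mul (.mul (.const 2) (.add .vb (.const (j + 1)))) (Bexpr j)) (.mul .va (Dexpr j))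

/-- `DD_{j,c} = Π_{l=j+1}^{j+c}(q+m+l)` as an expression tree. -/
def DDexpr (j : ℕ) : ℕ → PExpr
  | 0 => .const 1
  | c + 1 => .mul (DDexpr j c) (.add (.add .va .vb) (.const (j + c + 1)))

/-- `D_j(q,m)`. -/
def chainD (q m : ℚ) (j : ℕ) : ℚ := evalE q m (Dexpr j)

/-- `A_j(q,m)`. -/
def chainA (q m : ℚ) (j : ℕ) : ℚ := evalE q m (Aexpr j)

/-- `B_j(q,m)`. -/
def chainB (q m : ℚ) (j : ℕ) : ℚ := evalE q m (Bexpr j)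

/-- `DD_{j,c}(q,m)`. -/
def chainDD (q m : ℚ) (j c : ℕ) : ℚ := evalE q m (DDexpr j c)

/-- `D_0 = 1`. -/
lemma chainD_zero (q m : ℚ) : chainD q m 0 = 1 := by simp [chainD, Dexpr, evalE]

/-- `D_{j+1} = D_j·(q+m+j+1)`. -/
lemma chainD_succ (q m : ℚ) (j : ℕ) : chainD q m (j + 1) = chainD q m j * (q + m + (j + 1)) := by
  simp [chainD, Dexpr, evalE]

/-- `A_0 = 1`. -/
lemma chainA_zero (q m : ℚ) : chainA q m 0 = 1 := by simp [chainA, Aexpr, evalE]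

/-- `A_{j+1} = A_j·2(m+j+1)`. -/
lemma chainA_succ (q m : ℚ) (j : ℕ) : chainA q m (j + 1) = chainA q m j * (2 * (m + (j + 1))) := by
  simp [chainA, Aexpr, evalE]

/-- `B_0 = 0`. -/
lemma chainB_zero (q m : ℚ) : chainB q m 0 = 0 := by simp [chainB, Bexpr, evalE]

/-- `B_{j+1} = 2(m+j+1)·B_j + q·D_j`. -/
lemma chainB_succ (q m : ℚ) (j : ℕ) :
    chainB q m (j + 1) = 2 * (m + (j + 1)) * chainB q m j + q * chainD q m j := by
  simp [chainB, Bexpr, evalE, chainD]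

/-- `DD_{j,0} = 1`. -/
lemma chainDD_zero (q m : ℚ) (j : ℕ) : chainDD q m j 0 = 1 := by simp [chainDD, DDexpr, evalE]

/-- `DD_{j,c+1} = DD_{j,c}·(q+m+j+c+1)`. -/
lemma chainDD_succ (q m : ℚ) (j c : ℕ) :
    chainDD q m j (c + 1) = chainDD q m j c * (q + m + (j + c + 1)) := by
  simp [chainDD, DDexpr, evalE]

/-- `D_j > 0` for `q, m ≥ 0`. -/
lemma chainD_pos (q m : ℚ) (hq : 0 ≤ q) (hm : 0 ≤ m) (j : ℕ) : 0 < chainD q m j := by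
  induction j with
  | zero => rw [chainD_zero]; exact one_pos
  | succ j ih => rw [chainD_succ]; positivity

/-- `D_{j+c} = DD_{j,c}·D_j`. -/
lemma chainD_add (q m : ℚ) (j c : ℕ) : chainD q m (j + c) = chainDD q m j c * chainD q m j := by
  induction c with
  | zero => simp [chainDD_zero]
  | succ c ih =>
    rw [show j + (c + 1) = (j + c) + 1 by ring, chainD_succ, ih, chainDD_succ]
    push_cast
    ring

/-- **The chain**: `D_j·S(q,m+j) = A_j·S(q,m) + B_j`. -/
theorem chain_eq (q m : ℕ) (j : ℕ) :
    chainD q m j * sumS q (m + j) = chainA q m j * sumS q m + chainB q m j := by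
  induction j with
  | zero => simp [chainD_zero, chainA_zero, chainB_zero]
  | succ j ih =>
    have h := sumS_succ q (m + j)
    push_cast at h
    rw [chainD_succ, chainA_succ, chainB_succ, show m + (j + 1) = m + j + 1 by ring]
    linear_combination chainD (↑q) (↑m) j * h + (2 * ((m : ℚ) + (j + 1))) * ih

/-- `D_{j+c}·S(q,m+j) = DD_{j,c}·(A_j·S(q,m) + B_j)`. -/
theorem chainD_sumS (q m : ℕ) (j c : ℕ) :
    chainD q m (j + c) * sumS q (m + j) = chainDD q m j c * (chainA q m j * sumS q m + chainB q m j) := by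
  rw [chainD_add, mul_assoc, chain_eq]

end PercRepro
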